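import Literature.Topology.FourManifolds.SurfaceGroupCayleyFaces
import HarnessLib

/-!
# The Cayley complex of the surface group: the vertex link, the fan lemma, dual connectivity

Topic `Literature/Topology/FourManifolds`.  Third file of pillar **(B)** (planar counting,
Zieschang–Vogt–Coldewey Thm. 5.4.2 / Cor. 5.4.3) of the algebraic proof of Nielsen's theorem
(`SurfaceGroupCayleyPaths.lean`, `SurfaceGroupCayleyFaces.lean`).

* **The link of a vertex is a single cycle** (the one-vertex property of `r_g`): the `4g`
  out-letters `ℓ` at a vertex `u` and the `4g` corners of faces at `u` alternate along the cycle
  `a₀, b₀⁻¹, a₀⁻¹, b₀, a₁, …` (`lnext`); the opposite face of the out-letter `ℓ` is the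
  same-direction face of the next out-letter (`oface_eq_sface_lnext`), and `lnext` is a `4g`-cycle
  (`lnat_iterate`, `dvd_of_iterate_lnext_eq`, `exists_iterate_lnext_eq`).
* **Dual adjacency avoiding a `1`-chain `T`**: two faces are `T`-adjacent if they are the two
  faces of an edge `e` with `T e = 0` (`FaceRel`), `FaceConn T` is the generated equivalence; a
  `2`-chain with boundary `T` is constant on `FaceConn T`-classes (`apply_eq_of_faceConn`).
* **Fan lemma** (`faceConn_oface_sface`): if all out-edges at `u` other than those of two distinct
  out-letters `ℓ₁, ℓ₂` avoid `T`, then the opposite face of `ℓ₁` is `T`-connected to the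
  same-direction face of `ℓ₂` through the corners at `u`.
* **Connectivity of the dual graph** (`faceConn_zero`): any two faces are `0`-connected; and the
  transfer lemma `faceConn_or_exists_of_faceConn_zero`: along a `0`-walk either no edge of the
  support of `T` is crossed, or one reaches a face of such an edge.

## References

* H. Zieschang, E. Vogt, H.-D. Coldewey, *Surfaces and Planar Discontinuous Groups*, LNM 835,
  Springer (1980), §5.4 (Thm. 5.4.2, Cor. 5.4.3). [ZieschangVogtColdewey1980]
-/

noncomputable section

namespace Literature.Topology.FourManifolds

open Literature.GroupTheory.CombinatorialGroupTheory List

namespace SurfaceGroup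

variable {g : ℕ}

/-! ## The link cycle at a vertex -/

/-- The cyclic successor of a handle index. [folklore] -/
def finRot (i : Fin g) : Fin g := ⟨((i : ℕ) + 1) % g, Nat.mod_lt _ i.pos⟩

/-- **The link cycle**: the cyclic successor of an out-letter at a vertex of the Cayley complex,
`aᵢ ↦ bᵢ⁻¹ ↦ aᵢ⁻¹ ↦ bᵢ ↦ aᵢ₊₁` (indices mod `g`). [cite: ZieschangVogtColdewey1980, §5.4] -/
def lnext : surfaceGen g × Bool → surfaceGen g × Bool
  | ((i, false), true) => ((i, true), false)
  | ((i, true), false) => ((i, false), false)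
  | ((i, false), false) => ((i, true), true)
  | ((i, true), true) => ((finRot i, false), true)

/-- The index of an out-letter along the link cycle: `aᵢ ↦ 4i`, `bᵢ⁻¹ ↦ 4i+1`, `aᵢ⁻¹ ↦ 4i+2`,
`bᵢ ↦ 4i+3`. [folklore] -/
def lnat : surfaceGen g × Bool → ℕ
  | ((i, false), true) => 4 * i
  | ((i, true), false) => 4 * i + 1
  | ((i, false), false) => 4 * i + 2
  | ((i, true), true) => 4 * i + 3

/-- **Consecutive corners**: the opposite face of the out-letter `ℓ` at `u` is the same-direction
face of the next out-letter. [cite: ZieschangVogtColdewey1980, §5.4] -/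
theorem oface_eq_sface_lnext (u : SurfaceGroup g) (ℓ : surfaceGen g × Bool) :
    oface u ℓ = sface u (lnext ℓ) := by
  obtain ⟨⟨i, _ | _⟩, _ | _⟩ := ℓ
  · simp [oface, sface, lnext, linv]
  · simp only [oface, sface, lnext, linv, Bool.not_true, pos_a_false, pos_b_false]
  · simp only [oface, sface, lnext, linv, Bool.not_false, pos_b_true, pos_a_false]
  · simp only [oface, sface, lnext, linv, Bool.not_true, pos_b_false, pos_a_true, finRot]
    rw [show 4 * (i : ℕ) + 3 + 1 = 4 * i + 4 by ring]
    rcases (Nat.succ_le_of_lt i.isLt).lt_or_eq with h | h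
    · rw [Nat.mod_eq_of_lt h, show 4 * ((i : ℕ) + 1) = 4 * i + 4 by ring]
    · rw [show (i : ℕ) + 1 = g from h, Nat.mod_self, mul_zero, rvtx_zero, show 4 * (i : ℕ) + 4 = 4 * g by omega,
        rvtx_length]

/-- Link indices are `< 4g`. [folklore] -/
theorem lnat_lt (ℓ : surfaceGen g × Bool) : lnat ℓ < 4 * g := by
  obtain ⟨⟨i, _ | _⟩, _ | _⟩ := ℓ <;> simp only [lnat] <;> have := i.isLt <;> omega

/-- The link index is injective. [folklore] -/
theorem lnat_injective : Function.Injective (lnat (g := g)) := by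
  rintro ⟨⟨i, _ | _⟩, _ | _⟩ ⟨⟨j, _ | _⟩, _ | _⟩ h <;>
    simp only [lnat, Prod.mk.injEq, Fin.ext_iff, and_true, and_false, Bool.false_eq_true,
      Bool.true_eq_false] at h ⊢ <;> omega

/-- **The link is a cycle**: the successor raises the link index by one modulo `4g`. [folklore] -/
theorem lnat_lnext (ℓ : surfaceGen g × Bool) : lnat (lnext ℓ) = (lnat ℓ + 1) % (4 * g) := by
  obtain ⟨⟨i, _ | _⟩, _ | _⟩ := ℓ <;> simp only [lnat, lnext, finRot] <;> have := i.isLt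
  · rw [Nat.mod_eq_of_lt (by omega)]
  · rw [Nat.mod_eq_of_lt (by omega)]
  · rw [Nat.mod_eq_of_lt (by omega)]
  · rw [show 4 * (i : ℕ) + 3 + 1 = 4 * (i + 1) by ring, Nat.mul_mod_mul_left]

/-- Iterating the successor. [folklore] -/
theorem lnat_iterate_lnext (ℓ : surfaceGen g × Bool) (n : ℕ) :
    lnat (lnext^[n] ℓ) = (lnat ℓ + n) % (4 * g) := by
  induction n with
  | zero => rw [Function.iterate_zero_apply, add_zero, Nat.mod_eq_of_lt (lnat_lt ℓ)]
  | succ n ih => rw [Function.iterate_succ_apply', lnat_lnext, ih, Nat.mod_add_mod, add_assoc]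

/-- A letter returns to itself only after full turns of the link. [folklore] -/
theorem dvd_of_iterate_lnext_eq {ℓ : surfaceGen g × Bool} {n : ℕ} (h : lnext^[n] ℓ = ℓ) : 4 * g ∣ n := by
  have h1 : (lnat ℓ + n) % (4 * g) = (lnat ℓ + 0) % (4 * g) := by
    rw [← lnat_iterate_lnext, h, add_zero, Nat.mod_eq_of_lt (lnat_lt ℓ)]
  have h2 : n % (4 * g) = 0 % (4 * g) := Nat.ModEq.add_left_cancel' (lnat ℓ) h1
  exact Nat.dvd_of_mod_eq_zero (by simpa using h2)

/-- **Every out-letter is reached along the link cycle** in fewer than `4g` steps. [folklore] -/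
theorem exists_iterate_lnext_eq (ℓ μ : surfaceGen g × Bool) : ∃ d < 4 * g, lnext^[d] ℓ = μ := by
  have hℓ := lnat_lt ℓ
  have hμ := lnat_lt μ
  refine ⟨(lnat μ + (4 * g - lnat ℓ)) % (4 * g), Nat.mod_lt _ (by omega), lnat_injective ?_⟩
  rw [lnat_iterate_lnext, Nat.add_mod_mod, show lnat ℓ + (lnat μ + (4 * g - lnat ℓ)) = lnat μ + 4 * g by omega,
    Nat.add_mod_right, Nat.mod_eq_of_lt hμ]

/-! ## Dual adjacency avoiding a `1`-chain -/

/-- **`T`-adjacency of faces**: `F`, `F'` are the two faces of an edge not in the support of `T`.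
[cite: ZieschangVogtColdewey1980, §5.4] -/
def FaceRel (T : Edge g →₀ ℤ) (F F' : SurfaceGroup g) : Prop :=
  ∃ e : Edge g, T e = 0 ∧ ((F = Fplus e ∧ F' = Fminus e) ∨ (F = Fminus e ∧ F' = Fplus e))

/-- **`T`-connectedness of faces**: the reflexive-transitive closure of `T`-adjacency (walks in
the dual graph crossing no edge of the support of `T`). [cite: ZieschangVogtColdewey1980, §5.4] -/
def FaceConn (T : Edge g →₀ ℤ) : SurfaceGroup g → SurfaceGroup g → Prop := Relation.ReflTransGen (FaceRel T)

/-- `T`-adjacency is symmetric. [folklore] -/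
theorem FaceRel.symm {T : Edge g →₀ ℤ} {F F' : SurfaceGroup g} (h : FaceRel T F F') : FaceRel T F' F := by
  obtain ⟨e, he, h⟩ := h
  exact ⟨e, he, h.symm.imp (fun h => ⟨h.2, h.1⟩) (fun h => ⟨h.2, h.1⟩)⟩

/-- `T`-connectedness is reflexive. [folklore] -/
theorem FaceConn.refl (T : Edge g →₀ ℤ) (F : SurfaceGroup g) : FaceConn T F F := Relation.ReflTransGen.refl

/-- `T`-connectedness is transitive. [folklore] -/
theorem FaceConn.trans {T : Edge g →₀ ℤ} {F₁ F₂ F₃ : SurfaceGroup g} (h₁ : FaceConn T F₁ F₂) (h₂ : FaceConn T F₂ F₃) :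
    FaceConn T F₁ F₃ :=
  Relation.ReflTransGen.trans h₁ h₂

/-- `T`-connectedness is symmetric. [folklore] -/
theorem FaceConn.symm {T : Edge g →₀ ℤ} {F F' : SurfaceGroup g} (h : FaceConn T F F') : FaceConn T F' F := by
  induction h with
  | refl => exact FaceConn.refl T F
  | tail _ hst ih => exact Relation.ReflTransGen.head hst.symm ih

/-- One `T`-adjacency is a `T`-connection. [folklore] -/
theorem FaceRel.faceConn {T : Edge g →₀ ℤ} {F F' : SurfaceGroup g} (h : FaceRel T F F') : FaceConn T F F' :=
  Relation.ReflTransGen.single h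

/-- **The two faces of the edge of an out-letter avoiding `T` are `T`-connected.** [folklore] -/
theorem faceConn_sface_oface {T : Edge g →₀ ℤ} (u : SurfaceGroup g) (μ : surfaceGen g × Bool)
    (h : T (edgeOf u μ) = 0) : FaceConn T (sface u μ) (oface u μ) := by
  rcases Fplus_Fminus_edgeOf u μ with ⟨_, h1, h2⟩ | ⟨_, h1, h2⟩
  · exact FaceRel.faceConn ⟨edgeOf u μ, h, Or.inl ⟨h1.symm, h2.symm⟩⟩
  · exact FaceRel.faceConn ⟨edgeOf u μ, h, Or.inr ⟨h2.symm, h1.symm⟩⟩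

/-- **A `2`-chain is constant on the `T`-classes of faces when its boundary is `T`.**
[cite: ZieschangVogtColdewey1980, §5.4] -/
theorem apply_eq_of_faceConn {T : Edge g →₀ ℤ} {n : SurfaceGroup g →₀ ℤ}
    (hT : ∀ e, T e = n (Fplus e) - n (Fminus e)) {F F' : SurfaceGroup g} (h : FaceConn T F F') : n F = n F' := by
  induction h with
  | refl => rfl
  | tail _ hst ih =>
    obtain ⟨e, he, h⟩ := hst
    rw [hT, sub_eq_zero] at he
    rcases h with ⟨rfl, rfl⟩ | ⟨rfl, rfl⟩
    · rw [ih, he]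
    · rw [ih, he]

/-! ## The fan lemma -/

/-- Walking along the link from the successor of `ℓ₁`: as long as the out-letters met avoid `T`,
the corners stay `T`-connected. [folklore] -/
theorem faceConn_sface_iterate {T : Edge g →₀ ℤ} (u : SurfaceGroup g) (ℓ₁ : surfaceGen g × Bool) {d : ℕ}
    (h0 : ∀ j, 1 ≤ j → j < d → T (edgeOf u (lnext^[j] ℓ₁)) = 0) {j : ℕ} (hj : 1 ≤ j) (hjd : j ≤ d) :
    FaceConn T (sface u (lnext ℓ₁)) (sface u (lnext^[j] ℓ₁)) := by
  induction j, hj using Nat.le_induction with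
  | base => exact FaceConn.refl _ _
  | succ j hj ih =>
    refine (ih (by omega)).trans ?_
    rw [Function.iterate_succ_apply', ← oface_eq_sface_lnext]
    exact faceConn_sface_oface u _ (h0 j hj (by omega))

/-- **Fan lemma**: at a vertex `u`, if the out-edges of all out-letters other than two distinct
ones `ℓ₁ ≠ ℓ₂` avoid the support of `T`, then the opposite face of `ℓ₁` is `T`-connected to the
same-direction face of `ℓ₂` (through the corners at `u` on the arc of the link from `ℓ₁` to `ℓ₂`).
[cite: ZieschangVogtColdewey1980, proof of Thm. 5.4.2] -/
theorem faceConn_oface_sface (T : Edge g →₀ ℤ) (u : SurfaceGroup g) {ℓ₁ ℓ₂ : surfaceGen g × Bool} (hne : ℓ₁ ≠ ℓ₂)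
    (h0 : ∀ μ, μ ≠ ℓ₁ → μ ≠ ℓ₂ → T (edgeOf u μ) = 0) : FaceConn T (oface u ℓ₁) (sface u ℓ₂) := by
  obtain ⟨d, hd, hℓ⟩ := exists_iterate_lnext_eq ℓ₁ ℓ₂
  have hd0 : d ≠ 0 := by
    rintro rfl
    exact hne hℓ
  rw [oface_eq_sface_lnext, ← hℓ]
  refine faceConn_sface_iterate u ℓ₁ (fun j hj hjd => h0 _ (fun h => ?_) (fun h => ?_)) (Nat.one_le_iff_ne_zero.2 hd0) le_rfl
  · have := Nat.le_of_dvd (by omega) (dvd_of_iterate_lnext_eq h)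
    omega
  · rw [← hℓ, show d = (d - j) + j by omega, Function.iterate_add_apply] at h
    have := Nat.le_of_dvd (by omega) (dvd_of_iterate_lnext_eq h.symm)
    omega

/-! ## Connectivity of the dual graph -/

/-- All corners at a vertex are `0`-connected. [folklore] -/
theorem faceConn_zero_sface_sface (u : SurfaceGroup g) (ℓ μ : surfaceGen g × Bool) :
    FaceConn 0 (sface u ℓ) (sface u μ) := by
  by_cases h : ℓ = μ
  · rw [h]; exact FaceConn.refl _ _
  · exact (faceConn_sface_oface (T := 0) u ℓ rfl).trans (faceConn_oface_sface 0 u h fun _ _ _ => rfl)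

/-- Corners at adjacent vertices are `0`-connected. [folklore] -/
theorem faceConn_zero_sface_sface_mul (u : SurfaceGroup g) (ℓ μ : surfaceGen g × Bool) :
    FaceConn 0 (sface u ℓ) (sface (u * lval ℓ) μ) := by
  rw [sface_eq_oface_linv]
  exact (faceConn_sface_oface (T := 0) _ _ rfl).symm.trans (faceConn_zero_sface_sface _ _ _)

/-- Every corner is `0`-connected to a corner at `1`. [folklore] -/
theorem faceConn_zero_sface_one (ℓ : surfaceGen g × Bool) (v : SurfaceGroup g) :
    FaceConn 0 (sface 1 ℓ) (sface v ℓ) := by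
  obtain ⟨x, rfl⟩ := PresentedGroup.mk_surjective _ v
  rw [← FreeGroup.mk_toWord (x := x)]
  induction x.toWord using List.reverseRecOn with
  | nil => rw [← FreeGroup.one_eq_mk, map_one]; exact FaceConn.refl _ _
  | append_singleton L a ih =>
    rw [← FreeGroup.mul_mk, map_mul]
    refine ih.trans ?_
    have : (PresentedGroup.mk {surfaceRelator g}) (FreeGroup.mk [a]) = lval a := proj_mk_singleton a
    rw [this]
    exact (faceConn_zero_sface_sface _ ℓ a).trans (faceConn_zero_sface_sface_mul _ a ℓ)

/-- Every face is its own corner number `0`: `F = sface F a₀`. [folklore] -/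
theorem sface_a_zero (hg : 1 ≤ g) (F : SurfaceGroup g) : sface F ((⟨0, hg⟩, false), true) = F := by
  rw [sface, pos_a_true, Fin.val_mk, mul_zero, rvtx_zero, inv_one, mul_one]

/-- **The dual graph of the Cayley complex is connected**: any two faces are `0`-connected.
[cite: ZieschangVogtColdewey1980, §5.4] -/
theorem faceConn_zero (hg : 1 ≤ g) (F F' : SurfaceGroup g) : FaceConn 0 F F' := by
  rw [← sface_a_zero hg F, ← sface_a_zero hg F']
  exact (faceConn_zero_sface_one _ F).symm.trans (faceConn_zero_sface_one _ F')

/-- **Transfer along a `0`-walk**: two `0`-connected faces are `T`-connected, unless the walk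
crosses an edge `e` of the support of `T`, in which case the first face is `T`-connected to a
face of such an edge. [folklore] -/
theorem faceConn_or_exists_of_faceConn_zero (T : Edge g →₀ ℤ) {F F' : SurfaceGroup g} (h : FaceConn 0 F F') :
    FaceConn T F F' ∨ ∃ e, T e ≠ 0 ∧ (FaceConn T F (Fplus e) ∨ FaceConn T F (Fminus e)) := by
  induction h using Relation.ReflTransGen.head_induction_on with
  | refl => exact Or.inl (FaceConn.refl _ _)
  | head hst _ ih =>
    obtain ⟨e, -, he⟩ := hst
    by_cases hT : T e = 0
    · have hrel : FaceRel T _ _ := ⟨e, hT, he⟩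
      rcases ih with ih | ⟨e', he', ih⟩
      · exact Or.inl (Relation.ReflTransGen.head hrel ih)
      · exact Or.inr ⟨e', he', ih.imp (Relation.ReflTransGen.head hrel) (Relation.ReflTransGen.head hrel)⟩
    · refine Or.inr ⟨e, hT, ?_⟩
      rcases he with ⟨rfl, -⟩ | ⟨rfl, -⟩
      · exact Or.inl (FaceConn.refl _ _)
      · exact Or.inr (FaceConn.refl _ _)

end SurfaceGroup

end Literature.Topology.FourManifolds
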